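import Mathlib
import Literature.Analysis.FluidPDE.LerayHopf
import Literature.Analysis.FluidPDE.LerayHopfTranslate
import Literature.Analysis.FluidPDE.LerayHopfRestart
import Literature.Analysis.FluidPDE.LerayHopfRestartEverywhere
import Literature.Analysis.FluidPDE.TaoH1AlmostRegularAssembly
import Summits.NavierStokesRegularity.NavierStokesRegularity.Theses.RootDecompEpochRecut
import HarnessLib

/-!
# RootDecompEpochRecut — aside RB∞ `AtomFreeRestart` (stmt-NavierStokesRegularity-30484) PROVED

Route N21 `route-NavierStokesRegularity-RootDecompEpochRecut` (lens-3 g7 «THE EPOCH RECUT»; writer g3), aside item RB∞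
(«COSTUME(plumbing), PROVABLE NOW — the everywhere version of the tree's a.e. restart
`IsLerayHopfOn.ae_isLerayHopfOn_restart`»): **a global Leray–Hopf flow with no energy defect at `τ > 0` restarts
at `τ`** — if `‖u t − u τ‖_{L²} → 0` as `t ↑ τ`, then `s ↦ u (s + τ)` is a global Leray–Hopf flow from every
`ψ = u τ` a.e.

Proof: the only field of the Leray–Hopf structure of the translate that is not a translate of a field of `u` is
the energy inequality FROM `τ` (for the structure's weak-gradient witness `G`). It holds from a.e. `s < τ`; for a
good `s < τ ≤ t`, `E(u t) + ν∫_τ^t |G|² ≤ E(u t) + ν∫_s^t |G|² ≤ E(u s)`, and `E(u s) → E(u τ)` as `s ↑ τ` along good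
times by the LEFT `L²`-continuity at `τ` (`tendsto_kineticEnergy_nhdsLT`); good times accumulate at `τ` from the
left because they have full measure. With the energy inequality from `τ` in hand the construction of
`IsLerayHopfOn.ae_isLerayHopfOn_restart` (`LerayHopfRestart.lean`) goes through verbatim at `s = τ`
(`isLerayHopfOn_translate_of_tendsto_eLpNorm_sub_nhdsLT`: weak formulation `isWeakNSSolutionOn_translate`,
translated bounds and weak gradient, weak continuity on `(0, T] ∋ τ`, strong right-continuity at `τ` from the
energy decrease `IsLerayHopfOn.tendsto_eLpNorm_sub_nhdsGT`), and the datum is re-based to `ψ = u τ` a.e. by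
`IsLerayHopfOn.congr_datum_ae`. Plumbing (support of U 25531's dossier; with SEP 30483, landed p793346, the
separation calculus U ⟺ NIE ∧ AEU is unconditional); Navier–Stokes regularity is NOT proved by anything here
(rung 0).
-/

noncomputable section

-- the summit and its single sub-problem share the name (CONVENTIONS §1), as in every Theorems file
set_option linter.dupNamespace false

open MeasureTheory Set Filter Topology
open scoped ENNReal NNReal InnerProductSpace RealInnerProductSpace
open Literature.Analysis.FluidPDE

namespace Summit.NavierStokesRegularity.NavierStokesRegularity.Theorems.EpochRecut

variable {T ν : ℝ} {f : ℝ → EuclideanSpace ℝ (Fin 3) → EuclideanSpace ℝ (Fin 3)}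
  {u₀ : EuclideanSpace ℝ (Fin 3) → EuclideanSpace ℝ (Fin 3)}
  {u : ℝ → EuclideanSpace ℝ (Fin 3) → EuclideanSpace ℝ (Fin 3)}

/-! ### Left `L²`-continuity gives left continuity of the kinetic energy -/

/-- If a Leray–Hopf solution on `[0, T]` is strongly `L²`-continuous from the left at `τ ∈ (0, T]`, its kinetic
energy is continuous from the left at `τ` (`|‖u t‖₂ − ‖u τ‖₂| ≤ ‖u t − u τ‖₂`; the proof of the tree's
`ContinuousInLpOn.tendsto_kineticEnergy` at the left filter). [folklore] -/
theorem tendsto_kineticEnergy_nhdsLT (h : IsLerayHopfOn T ν f u₀ u) {τ : ℝ} (hτ : τ ∈ Ioc 0 T)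
    (hleft : Tendsto (fun t => eLpNorm (u t - u τ) 2 volume) (𝓝[<] τ) (𝓝 0)) :
    Tendsto (fun t => VectorCalculus.kineticEnergy (u t)) (𝓝[<] τ)
      (𝓝 (VectorCalculus.kineticEnergy (u τ))) := by
  set a : ℝ → ℝ := fun t => (eLpNorm (u t) 2 volume).toReal with ha
  have h0 : MemLp (u τ) 2 volume := h.memLp τ ⟨hτ.1.le, hτ.2⟩
  have hmem : ∀ᶠ t in 𝓝[<] τ, MemLp (u t) 2 volume := by
    filter_upwards [Ioo_mem_nhdsLT hτ.1] with t ht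
    exact h.memLp t ⟨ht.1.le, ht.2.le.trans hτ.2⟩
  have hd : Tendsto (fun t => (eLpNorm (u t - u τ) 2 volume).toReal) (𝓝[<] τ) (𝓝 0) := by
    have := (ENNReal.tendsto_toReal ENNReal.zero_ne_top).comp hleft
    rwa [ENNReal.toReal_zero] at this
  have hat : Tendsto a (𝓝[<] τ) (𝓝 (a τ)) := by
    rw [tendsto_iff_norm_sub_tendsto_zero]
    refine squeeze_zero' (Eventually.of_forall fun t => norm_nonneg _) ?_ hd
    filter_upwards [hmem] with t hi
    have hfi : eLpNorm (u t) 2 volume ≠ ⊤ := hi.eLpNorm_ne_top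
    have hf0 : eLpNorm (u τ) 2 volume ≠ ⊤ := h0.eLpNorm_ne_top
    have hdif : eLpNorm (u t - u τ) 2 volume ≠ ⊤ := (hi.sub h0).eLpNorm_ne_top
    have h1 : eLpNorm (u t) 2 volume ≤ eLpNorm (u t - u τ) 2 volume + eLpNorm (u τ) 2 volume := by
      have := eLpNorm_add_le (hi.sub h0).aestronglyMeasurable h0.aestronglyMeasurable
        (p := 2) (μ := volume) one_le_two
      rwa [sub_add_cancel] at this
    have h2 : eLpNorm (u τ) 2 volume ≤ eLpNorm (u t - u τ) 2 volume + eLpNorm (u t) 2 volume := by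
      have := eLpNorm_add_le (h0.sub hi).aestronglyMeasurable hi.aestronglyMeasurable
        (p := 2) (μ := volume) one_le_two
      rwa [sub_add_cancel, eLpNorm_sub_comm] at this
    have h1' := ENNReal.toReal_mono (ENNReal.add_ne_top.2 ⟨hdif, hf0⟩) h1
    have h2' := ENNReal.toReal_mono (ENNReal.add_ne_top.2 ⟨hdif, hfi⟩) h2
    rw [ENNReal.toReal_add hdif hf0] at h1'
    rw [ENNReal.toReal_add hdif hfi] at h2'
    rw [Real.norm_eq_abs, abs_sub_le_iff]
    constructor <;> linarith
  have hsq : Tendsto (fun t => 2⁻¹ * a t ^ 2) (𝓝[<] τ) (𝓝 (2⁻¹ * a τ ^ 2)) :=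
    (hat.pow 2).const_mul 2⁻¹
  rw [kineticEnergy_eq_half_toReal_eLpNorm_sq h0]
  refine hsq.congr' ?_
  filter_upwards [hmem] with t ht
  rw [kineticEnergy_eq_half_toReal_eLpNorm_sq ht]

/-! ### Restarting at a time of left `L²`-continuity -/

/-- **Restarting at every time of left `L²`-continuity.** Let `ν ≥ 0` and let `u` be a Leray–Hopf weak solution
of the unforced system on `ℝ³ × [0, T)` (Leray–Hopf in the strict sense: energy inequality from a.e. time). If
`u` is strongly `L²`-continuous from the LEFT at `τ ∈ (0, T)`, then the translate `u(· + τ)` is a Leray–Hopf weak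
solution on `[0, T − τ)` from `u(τ)`: the energy inequality from `τ` is the limit of the inequalities from good
times `s ↑ τ`; the rest is the construction of `IsLerayHopfOn.ae_isLerayHopfOn_restart` at `s = τ`.
[cite: RobinsonRodrigoSadowski2016, Def. 4.9 and p. 131 (proof of Thm. 8.17)] -/
theorem isLerayHopfOn_translate_of_tendsto_eLpNorm_sub_nhdsLT (hLH : IsLerayHopfOn T ν 0 u₀ u)
    (hν : 0 ≤ ν) {τ : ℝ} (hτI : τ ∈ Ioo 0 T)
    (hleft : Tendsto (fun t => eLpNorm (u t - u τ) 2 volume) (𝓝[<] τ) (𝓝 0)) :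
    IsLerayHopfOn (T - τ) ν 0 (u τ) (fun t => u (t + τ)) := by
  obtain ⟨C, hC⟩ := hLH.energy_bound
  obtain ⟨G, hG, hGint, -, hae⟩ := hLH.weakGrad_energy
  -- notation and elementary facts
  set g : ℝ → ℝ≥0∞ := fun σ => ∫⁻ x, ENNReal.ofReal (frobeniusNormSq (G σ x)) with hg
  have hforce : ∀ (a b : ℝ) (v : ℝ → EuclideanSpace ℝ (Fin 3) → EuclideanSpace ℝ (Fin 3)),
      ∫ σ in a..b, ∫ x, ⟪(0 : ℝ → EuclideanSpace ℝ (Fin 3) → EuclideanSpace ℝ (Fin 3)) σ x, v σ x⟫ = 0 := by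
    intro a b v
    simp
  have hae' : ∀ᵐ s ∂(volume.restrict (Ioo 0 T)), ∀ t ∈ Icc s T, VectorCalculus.kineticEnergy (u t) +
      ν * (∫⁻ σ in Ioo s t, g σ).toReal ≤ VectorCalculus.kineticEnergy (u s) := by
    filter_upwards [hae] with s hs t ht
    have h1 := hs t ht
    rwa [hforce, add_zero] at h1
  -- THE ENERGY INEQUALITY FROM `τ` (limit along good times `s ↑ τ`)
  have hs : ∀ t ∈ Icc τ T, VectorCalculus.kineticEnergy (u t) +
      ν * (∫⁻ σ in Ioo τ t, g σ).toReal ≤ VectorCalculus.kineticEnergy (u τ) := by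
    intro t ht
    set A : Set ℝ := {s' ∈ Ioo 0 τ | ∀ t' ∈ Icc s' T, VectorCalculus.kineticEnergy (u t') +
        ν * (∫⁻ σ in Ioo s' t', g σ).toReal ≤ VectorCalculus.kineticEnergy (u s')} with hA
    have hclos : τ ∈ closure A := by
      rw [Metric.mem_closure_iff]
      intro ε hε
      set b : ℝ := max (τ / 2) (τ - ε / 2) with hb
      have hb0 : 0 < b := lt_of_lt_of_le (by linarith [hτI.1]) (le_max_left _ _)
      have hbτ : b < τ := max_lt (by linarith [hτI.1]) (by linarith)
      have hsub : Ioo b τ ⊆ Ioo 0 T := fun σ hσ => ⟨hb0.trans hσ.1, hσ.2.trans hτI.2⟩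
      have hae'' : ∀ᵐ s' ∂(volume.restrict (Ioo b τ)), ∀ t' ∈ Icc s' T,
          VectorCalculus.kineticEnergy (u t') + ν * (∫⁻ σ in Ioo s' t', g σ).toReal ≤
            VectorCalculus.kineticEnergy (u s') :=
        ae_mono (Measure.restrict_mono hsub le_rfl) hae'
      obtain ⟨s', hs', hgood⟩ : ∃ s' ∈ Ioo b τ, ∀ t' ∈ Icc s' T,
          VectorCalculus.kineticEnergy (u t') + ν * (∫⁻ σ in Ioo s' t', g σ).toReal ≤
            VectorCalculus.kineticEnergy (u s') := by
        by_contra hne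
        push Not at hne
        have hfalse : ∀ᵐ s' ∂((volume : Measure ℝ).restrict (Ioo b τ)), False := by
          filter_upwards [hae'', ae_restrict_mem measurableSet_Ioo] with s' h1 h2
          obtain ⟨t', ht', hlt⟩ := hne s' h2
          exact absurd (h1 t' ht') (not_le.2 hlt)
        rw [eventually_false_iff_eq_bot, ae_eq_bot, Measure.restrict_eq_zero, Real.volume_Ioo] at hfalse
        exact absurd hfalse (ENNReal.ofReal_pos.2 (by linarith)).ne'
      refine ⟨s', ⟨⟨hb0.trans hs'.1, hs'.2⟩, hgood⟩, ?_⟩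
      rw [Real.dist_eq, abs_of_pos (sub_pos.2 hs'.2)]
      linarith [le_max_right (τ / 2) (τ - ε / 2), hs'.1]
    haveI hne : (𝓝[A] τ).NeBot := mem_closure_iff_nhdsWithin_neBot.1 hclos
    have hleA : 𝓝[A] τ ≤ 𝓝[<] τ := nhdsWithin_mono _ fun s' hs' => hs'.1.2
    have hfin : ∀ s' : ℝ, 0 ≤ s' → (∫⁻ σ in Ioo s' t, g σ) ≠ ∞ := fun s' hs' =>
      (lt_of_le_of_lt (lintegral_mono_set (show Ioo s' t ⊆ Ioo 0 T from
        fun σ hσ => ⟨hs'.trans_lt hσ.1, hσ.2.trans_le ht.2⟩)) hGint).ne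
    have hineq : ∀ᶠ s' in 𝓝[A] τ, VectorCalculus.kineticEnergy (u t) +
        ν * (∫⁻ σ in Ioo τ t, g σ).toReal ≤ VectorCalculus.kineticEnergy (u s') := by
      refine eventually_mem_nhdsWithin.mono fun s' hs' => ?_
      have h1 := hs'.2 t ⟨hs'.1.2.le.trans ht.1, ht.2⟩
      have hmono : (∫⁻ σ in Ioo τ t, g σ).toReal ≤ (∫⁻ σ in Ioo s' t, g σ).toReal :=
        ENNReal.toReal_mono (hfin s' hs'.1.1.le) (lintegral_mono_set (Ioo_subset_Ioo hs'.1.2.le le_rfl))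
      have h2 := mul_le_mul_of_nonneg_left hmono hν
      linarith
    have hlimR : Tendsto (fun s' => VectorCalculus.kineticEnergy (u s')) (𝓝[A] τ)
        (𝓝 (VectorCalculus.kineticEnergy (u τ))) :=
      (tendsto_kineticEnergy_nhdsLT hLH ⟨hτI.1, hτI.2.le⟩ hleft).mono_left hleA
    exact ge_of_tendsto hlimR hineq
  -- the construction of `IsLerayHopfOn.ae_isLerayHopfOn_restart` at `s = τ`
  have hEs : ∀ t ∈ Icc τ T, VectorCalculus.kineticEnergy (u t) ≤ VectorCalculus.kineticEnergy (u τ) := by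
    intro t ht
    have h1 := hs t ht
    have h2 : 0 ≤ ν * (∫⁻ σ in Ioo τ t, g σ).toReal := mul_nonneg hν ENNReal.toReal_nonneg
    linarith
  have hsub : Ioo (0 + τ) (T - τ + τ) ⊆ Ioo 0 T := fun t ht =>
    ⟨by linarith [ht.1, hτI.1], by linarith [ht.2]⟩
  have hμ : volume.restrict (Ioo (0 + τ) (T - τ + τ)) ≤ volume.restrict (Ioo 0 T) :=
    Measure.restrict_mono hsub le_rfl
  -- the shift `t ↦ t + τ` at the filter `𝓝[>] 0 → 𝓝 τ`
  have hsh : Tendsto (fun t : ℝ => t + τ) (𝓝[>] (0 : ℝ)) (𝓝 τ) := by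
    have h1 : Tendsto (fun t : ℝ => t + τ) (𝓝 0) (𝓝 (0 + τ)) :=
      (continuous_id.add continuous_const).tendsto 0
    rw [zero_add] at h1
    exact h1.mono_left nhdsWithin_le_nhds
  have hsh' : Tendsto (fun t : ℝ => t + τ) (𝓝[>] (0 : ℝ)) (𝓝[>] τ) := by
    refine tendsto_nhdsWithin_iff.2 ⟨hsh, ?_⟩
    filter_upwards [self_mem_nhdsWithin] with t ht
    exact show τ < t + τ by linarith [mem_Ioi.1 ht]
  refine
    { weak := hLH.isWeakNSSolutionOn_translate hτI hEs
      energy_bound := ⟨C, ae_restrict_Ioo_comp_add_right τ (ae_mono hμ hC)⟩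
      memLp := fun t ht => hLH.memLp (t + τ) ⟨by linarith [ht.1, hτI.1], by linarith [ht.2]⟩
      weakGrad_energy := ⟨fun t => G (t + τ), ae_restrict_Ioo_comp_add_right τ (ae_mono hμ hG),
        ?_, ?_, ?_⟩
      weak_continuous := fun w hw => ?_
      strong_initial := (hLH.tendsto_eLpNorm_sub_nhdsGT hτI hEs).comp hsh' }
  · -- `∇u(· + τ) ∈ L²_{t,x}`
    have h1 := setLIntegral_Ioo_comp_add_right g 0 (T - τ) τ
    calc ∫⁻ t in Ioo 0 (T - τ), ∫⁻ x, ENNReal.ofReal (frobeniusNormSq (G (t + τ) x))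
        = ∫⁻ t in Ioo (0 + τ) (T - τ + τ), g t := h1
      _ ≤ ∫⁻ t in Ioo 0 T, g t := lintegral_mono_set hsub
      _ < ∞ := hGint
  · -- energy inequality from `0` (= from `τ` for `u`)
    intro t ht
    rw [hforce, add_zero, setLIntegral_Ioo_comp_add_right g 0 t τ, zero_add]
    exact hs (t + τ) ⟨by linarith [ht.1], by linarith [ht.2]⟩
  · -- energy inequality from a.e. `s'`
    have h1 := ae_restrict_Ioo_comp_add_right τ (ae_mono hμ hae)
    filter_upwards [h1] with s' hs' t ht
    rw [hforce, add_zero, setLIntegral_Ioo_comp_add_right g s' t τ]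
    have h2 := hs' (t + τ) ⟨by linarith [ht.1], by linarith [ht.2]⟩
    rwa [hforce, add_zero] at h2
  · -- weak `L²` continuity on `(0, T - τ]` and the weak limit at `0⁺`
    obtain ⟨hco, -⟩ := hLH.weak_continuous w hw
    refine ⟨hco.comp (continuousOn_id.add continuousOn_const) fun t ht =>
      ⟨by linarith [ht.1, hτI.1], by linarith [ht.2]⟩, ?_⟩
    exact (hco.continuousAt (Ioc_mem_nhds hτI.1 hτI.2)).tendsto.comp hsh

/-! ### The aside -/

/-- **Aside RB∞ `AtomFreeRestart` (stmt-NavierStokesRegularity-30484) holds**: a global Leray–Hopf flow with no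
energy defect at `τ > 0` (strong `L²`-continuity from the left at `τ`) restarts at `τ` — `s ↦ u (s + τ)` is a
global Leray–Hopf flow from every `ψ = u τ` a.e. (restart on `[0, T' ]` for every `T'` from the structure on
`[0, T' + τ]`, then the datum re-based along the a.e. equality).
[cite: RobinsonRodrigoSadowski2016, Def. 4.9 and p. 131 (proof of Thm. 8.17)] -/
theorem atomFreeRestart_proof : Theses.RootDecompEpochRecut.AtomFreeRestart := by
  unfold Theses.RootDecompEpochRecut.AtomFreeRestart
  intro ν hν u₀ u hG τ hτ hleft ψ hψ T' hT'
  have hLH : IsLerayHopfOn (T' + τ) ν 0 u₀ u := hG (T' + τ) (by linarith)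
  have h1 : IsLerayHopfOn (T' + τ - τ) ν 0 (u τ) (fun s => u (s + τ)) :=
    isLerayHopfOn_translate_of_tendsto_eLpNorm_sub_nhdsLT hLH hν.le ⟨hτ, by linarith⟩ hleft
  rw [add_sub_cancel_right] at h1
  exact h1.congr_datum_ae hψ

end Summit.NavierStokesRegularity.NavierStokesRegularity.Theorems.EpochRecut

end
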